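import Summits.CriticalPhenomena.PercolationContinuityZ3.Theorems.Transplant.FKThreeApexUCondRim
import Summits.CriticalPhenomena.PercolationContinuityZ3.Theorems.Transplant.FKThreeApexOmegaClosure2
import HarnessLib

/-!
# `(U_a)` SURVIVES RIM STEPS, and the upper-envelope conditions `U_a, U_b, U_c` hold on the whole double-fan closure `InKE`

Helper file (`--supports stmt-CriticalPhenomena-4575`), FK sub-lane `prim-bschramm-fk-3` (gen 25); builds on p205010 (kernel theorem,
internal audit signed; external expert review pending).  No sorries; standard axioms.  Memo `bschramm/prim-bschramm-fk-3/U-RIM.md`.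

From `…ThreeApexUCondRim` (linear structure of `Φ_a`, the flow `flow q t Z = Z + t·detach Z`, strict inflow `c₁ > 0` at the boundary of
`{J_a ≥ 0 ∨ Δ_U ≥ 0}`) a continuous induction on the time interval (`IsClosed.Icc_subset_of_forall_mem_nhdsWithin`) gives
**`UCond.flow`** and **`UCond.rimStep`**: for `0 < q ≤ 1`, `r ∈ [0,1]` and every fibre-mass vector with masses `≥ 0`,
`Φ_a(w₁,w₂)(Z) ≥ 0 ∀w ≥ 0 ⟹ Φ_a(w₁,w₂)(E_r Z) ≥ 0 ∀w ≥ 0` — the rim step of double fans (`…ThreeApexRimStep`) preserves `(U_a)`.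
With the semigroup theorem `InOmega.conv` (`…ThreeApexOmegaClosure2`) for products and the trivial scaling of the `c`-forms under `E_r`
(`uForm_swapAC_rimStep`), induction over `InKE` yields **`InKE.uCond`, `InKE.uCondB`, `InKE.uCondC`**: the three upper-envelope conditions
`U_a, U_b, U_c` hold for every vector of the rim-step closure `InKE q` of the three-apex monoid (`0 < q ≤ 1`) — the input "U on InKE" for the
generalized-T5 pair types of double fans (axis–rim, cross-apex spokes; memos `RIM-PAIRS.md` Finding A, `DOUBLE-FAN.md` §5).
[cite: Grimmett2006, §3.9 eq. (3.94) (pp. 63–64)] [folklore]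
-/

noncomputable section

open Filter Topology Set

namespace Summit.CriticalPhenomena.PercolationContinuityZ3.Theorems

namespace FK

namespace ThreeApex

/-! ### Continuous induction along the ray -/

/-- The closed condition `J_a ≥ 0 ∨ Δ_U ≥ 0` (equivalent to `(U_a)` for masses `≥ 0`, `uCond_iff_disc`). [folklore] -/
def UGood (q : ℝ) (Z : V5) : Prop := 0 ≤ jA Z ∨ 0 ≤ discU q Z

/-- A continuous function positive at `0` is positive on a right neighbourhood of `0`. [folklore] -/
theorem eventually_pos_nhdsGT {f : ℝ → ℝ} (hf : Continuous f) (h0 : 0 < f 0) : ∀ᶠ t in 𝓝[>] (0 : ℝ), 0 < f t :=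
  ((hf.tendsto 0).eventually (eventually_gt_nhds h0)).filter_mono nhdsWithin_le_nhds

/-- **Local step**: from a good point with masses `≥ 0` the flow stays good for small positive times (`0 < q ≤ 1`). [folklore] -/
theorem good_nhdsGT {q : ℝ} (hq0 : 0 < q) (hq1 : q ≤ 1) {Z : V5} (hZ : Z.Nonneg) (h : UGood q Z) :
    ∀ᶠ t in 𝓝[>] (0 : ℝ), UGood q (flow q t Z) := by
  have ht : ∀ᶠ t in 𝓝[>] (0 : ℝ), 0 < t := eventually_mem_nhdsWithin
  rcases lt_trichotomy 0 (jA Z) with hJ | hJ | hJ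
  · -- `J_a > 0`: by continuity
    have hc : Continuous fun t : ℝ => (1 + q * t) * jA Z - t * (Z.zac * (q * Z.zbc + Z.z1)) := by fun_prop
    have hev := eventually_pos_nhdsGT hc (by simpa using hJ)
    exact hev.mono fun t ht' => Or.inl (by rw [jA_flow]; exact ht'.le)
  · -- `J_a = 0`
    by_cases hYe : Z.zac * (q * Z.zbc + Z.z1) = 0
    · refine Eventually.of_forall fun t => Or.inl ?_
      rw [jA_flow, ← hJ, hYe]; simp
    · have hd : 0 < gflow q Z 0 := by rw [gflow_zero]; exact dc1_pos_of_jA_zero hq0 hq1 hZ hJ.symm hYe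
      have hev := eventually_pos_nhdsGT (continuous_gflow q Z) hd
      have hD0 : 0 ≤ discU q Z := by
        have e : discU q Z = 4 * Z.zab * Z.zac * wlin q Z ^ 2 := by simp only [discU, ← hJ]; ring
        rw [e]; have := wlin_nonneg hq0.le hZ; have := hZ.hab; have := hZ.hac; positivity
      filter_upwards [hev, ht] with t hg htp
      right
      rw [discU_flow]
      positivity
  · -- `J_a < 0`: then `Δ_U ≥ 0`
    have hD : 0 ≤ discU q Z := h.resolve_left (not_le.2 hJ)
    rcases hD.lt_or_eq with hD | hD
    · have hg := continuous_gflow q Z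
      have hc : Continuous fun t : ℝ => discU q Z + t * gflow q Z t := by fun_prop
      have hev := eventually_pos_nhdsGT hc (by simpa using hD)
      exact hev.mono fun t ht' => Or.inr (by rw [discU_flow]; exact ht'.le)
    · have hd : 0 < gflow q Z 0 := by rw [gflow_zero]; exact dc1_pos_of_boundary hq0 hq1 hZ hJ hD.symm
      have hev := eventually_pos_nhdsGT (continuous_gflow q Z) hd
      filter_upwards [hev, ht] with t hg htp
      right
      rw [discU_flow, ← hD]
      positivity

/-- **Invariance of `J_a ≥ 0 ∨ Δ_U ≥ 0` along the whole ray** (continuous induction on `[0, t]`). [folklore] -/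
theorem good_flow {q : ℝ} (hq0 : 0 < q) (hq1 : q ≤ 1) {Z : V5} (hZ : Z.Nonneg) (h : UGood q Z) {t : ℝ} (ht : 0 ≤ t) :
    UGood q (flow q t Z) := by
  let S : Set ℝ := {s | UGood q (flow q s Z)}
  have hS : S = {s : ℝ | 0 ≤ jA (flow q s Z)} ∪ {s : ℝ | 0 ≤ discU q (flow q s Z)} := Set.ext fun _ => Iff.rfl
  have hc1 : Continuous fun s : ℝ => jA (flow q s Z) := by
    have e : (fun s : ℝ => jA (flow q s Z)) = fun s => (1 + q * s) * jA Z - s * (Z.zac * (q * Z.zbc + Z.z1)) :=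
      funext fun s => jA_flow q s Z
    rw [e]; fun_prop
  have hc2 : Continuous fun s : ℝ => discU q (flow q s Z) := by
    have e : (fun s : ℝ => discU q (flow q s Z)) = fun s => discU q Z + s * gflow q Z s :=
      funext fun s => discU_flow q s Z
    have hg := continuous_gflow q Z
    rw [e]; fun_prop
  have hclosed : IsClosed S := by
    rw [hS]; exact (isClosed_le continuous_const hc1).union (isClosed_le continuous_const hc2)
  have key : Icc 0 t ⊆ S := by
    refine (hclosed.inter isClosed_Icc).Icc_subset_of_forall_mem_nhdsWithin ?_ ?_
    · show UGood q (flow q 0 Z)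
      rw [flow_zero]; exact h
    · rintro x ⟨hx, hx0, -⟩
      have hZx : (flow q x Z).Nonneg := flow_nonneg hq0.le hx0 hZ
      have hev := good_nhdsGT hq0 hq1 hZx hx
      obtain ⟨u, hu, hsub⟩ := mem_nhdsGT_iff_exists_Ioo_subset.1 hev
      have hu' : 0 < u := hu
      have hk : 0 < 1 + q * x := by positivity
      refine mem_nhdsGT_iff_exists_Ioo_subset.2 ⟨x + u * (1 + q * x), ?_, ?_⟩
      · show x < x + u * (1 + q * x)
        have : 0 < u * (1 + q * x) := mul_pos hu' hk
        linarith
      · rintro s ⟨hs1, hs2⟩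
        have hτ : (s - x) / (1 + q * x) ∈ Ioo 0 u := by
          constructor
          · exact div_pos (by linarith) hk
          · rw [div_lt_iff₀ hk]; linarith
        have hgood := hsub hτ
        simp only [mem_setOf_eq, flow_flow] at hgood
        have e : x + (s - x) / (1 + q * x) * (1 + q * x) = s := by field_simp; ring
        show UGood q (flow q s Z)
        rw [e] at hgood; exact hgood
  exact key ⟨ht, le_rfl⟩

/-! ### The theorem -/

/-- **`(U_a)` is invariant under the detach flow**: `U_a(Z) ⟹ U_a(Z + t·detach Z)` for `t ≥ 0` (masses `≥ 0`, `0 < q ≤ 1`). [folklore] -/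
theorem UCond.flow {q : ℝ} (hq0 : 0 < q) (hq1 : q ≤ 1) {Z : V5} (hZ : Z.Nonneg) (hU : UCond q Z) {t : ℝ} (ht : 0 ≤ t) :
    UCond q (ThreeApex.flow q t Z) :=
  uCond_of_disc hq0 hq1 (flow_nonneg hq0.le ht hZ) (good_flow hq0 hq1 hZ (hU.disc hq1) ht)

/-- Masses of `detach Z` are `≥ 0`. [folklore] -/
theorem detach_nonneg {q : ℝ} (hq : 0 ≤ q) {Z : V5} (hZ : Z.Nonneg) : (detach q Z).Nonneg := by
  obtain ⟨h0, h1, h2, h3, h4⟩ := hZ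
  refine ⟨?_, ?_, ?_, ?_, ?_⟩ <;> simp only [detach] <;> positivity

/-- **`(U_a)` SURVIVES RIM STEPS**: for `0 < q ≤ 1`, `r ∈ [0,1]` and every fibre-mass vector `Z` with masses `≥ 0`,
`Φ_a(w₁,w₂)(Z) ≥ 0 ∀ w₁,w₂ ≥ 0` implies `Φ_a(w₁,w₂)(E_r Z) ≥ 0 ∀ w₁,w₂ ≥ 0`. [folklore] -/
theorem UCond.rimStep {q r : ℝ} (hq0 : 0 < q) (hq1 : q ≤ 1) (hr0 : 0 ≤ r) (hr1 : r ≤ 1) {Z : V5} (hZ : Z.Nonneg)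
    (hU : UCond q Z) : UCond q (ThreeApex.rimStep q r Z) := by
  rcases hr0.eq_or_lt with h | h
  · rw [← h, rimStep_zero]
    have hJ : jA (detach q Z) = 0 := by simp only [jA_eq, detach]; ring
    exact uCond_of_disc hq0 hq1 (detach_nonneg hq0.le hZ) (Or.inl hJ.ge)
  · intro w₁ w₂ hw₁ hw₂
    rw [rimStep_eq_scaleV_flow q h.ne' Z, uForm_scaleV]
    have ht : 0 ≤ (1 - r) / r := div_nonneg (sub_nonneg.2 hr1) h.le
    exact mul_nonneg (sq_nonneg r) (hU.flow hq0 hq1 hZ ht w₁ w₂ hw₁ hw₂)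

/-! ### `U_a`, `U_b`, `U_c` on the rim-step closure `InKE` -/

/-- Relabelling `a ↔ c` (blocks `ab ↔ bc`). [folklore] -/
def swapAC (Z : V5) : V5 := ⟨Z.z0, Z.zbc, Z.zac, Z.zab, Z.z1⟩

/-- `swapAC = swapBC ∘ swapAB ∘ swapBC`. [folklore] -/
theorem swapAC_eq (Z : V5) : swapAC Z = swapBC (swapAB (swapBC Z)) := rfl

/-- `swapAC` is multiplicative. [folklore] -/
theorem swapAC_conv (z Z : V5) : swapAC (conv z Z) = conv (swapAC z) (swapAC Z) :=
  V5.ext rfl rfl rfl rfl (by simp only [swapAC, conv, V5.total]; ring)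

/-- Letters go to letters under `a ↔ c`. [folklore] -/
theorem IsLetter.swapAC {q : ℝ} {z : V5} (h : IsLetter q z) : IsLetter q (ThreeApex.swapAC z) := by
  rw [swapAC_eq]; exact h.swapBC.swapAB.swapBC

/-- **The `c`-forms scale under the rim step**: `Φ_c(w₁,w₂)(E_r Z) = r(r + (1−r)q)·Φ_c(w₁,w₂)(Z)`, where `Φ_c = Φ_a ∘ swapAC`
(`N^{(ac)}, N^{(bc)}, M_c` are all multiplied by `r(r+(1−r)q)`). [folklore] -/
theorem uForm_swapAC_rimStep (q r w₁ w₂ : ℝ) (Z : V5) :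
    uForm q w₁ w₂ (swapAC (ThreeApex.rimStep q r Z)) = r * (r + (1 - r) * q) * uForm q w₁ w₂ (swapAC Z) := by
  simp only [uForm, masterN, massA, swapBC, swapAC, ThreeApex.rimStep]; ring

/-- A valid vector with `Z_0 > 0` satisfying `(U_a)` lies in `Ω_q`. [folklore] -/
theorem inOmega_of_valid_uCond {q : ℝ} {Z : V5} (hv : Valid q Z) (hu : 0 < Z.z0) (hU : UCond q Z) : InOmega q Z := by
  obtain ⟨h0, h1, h2, h3, h4⟩ := hv.nonneg
  refine ⟨hu, ?_, ?_, ?_, ?_, ?_, hv.nAB, hv.nAC, hU⟩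
  · simp only [hz]; linarith
  · simp only [hx]; linarith
  · simp only [hy]; linarith
  · have e : Z.z0 * Z.total - hx Z * hz Z = kap Z := by simp only [kap, hx, hz, V5.total]; ring
    linarith [hv.kapA]
  · have e : Z.z0 * Z.total - hy Z * hz Z = kap (swapBC Z) := by simp only [kap, hy, hz, swapBC, V5.total]; ring
    linarith [hv.kapB]

/-- `(U_a)` holds trivially when `Z_0 = 0` (then `J_a ≥ 0`), for valid `Z` and `0 < q ≤ 1`. [folklore] -/
theorem uCond_of_z0_eq_zero {q : ℝ} (hq0 : 0 < q) (hq1 : q ≤ 1) {Z : V5} (hv : Valid q Z) (h0 : Z.z0 = 0) : UCond q Z := by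
  obtain ⟨_, h1, h2, h3, h4⟩ := hv.nonneg
  have hJ : 0 ≤ jA Z := by rw [jA_eq, h0]; nlinarith [mul_nonneg h3 h1, mul_nonneg h3 h2]
  exact uCond_of_disc hq0 hq1 hv.nonneg (Or.inl hJ)

/-- `(U_a)` of a product of two valid vectors that both satisfy `(U_a)` (`0 < q ≤ 1`): the semigroup theorem `InOmega.conv`
plus the degenerate case `Z_0 = 0`. [folklore] -/
theorem UCond.conv {q : ℝ} (hq0 : 0 < q) (hq1 : q ≤ 1) {z Z : V5} (hz : Valid q z) (hZ : Valid q Z) (hUz : UCond q z)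
    (hUZ : UCond q Z) : UCond q (ThreeApex.conv z Z) := by
  have hv : Valid q (ThreeApex.conv z Z) := hz.conv hq0.le hZ
  by_cases hu : 0 < (ThreeApex.conv z Z).z0
  · have hzz : (ThreeApex.conv z Z).z0 = z.z0 * Z.z0 := rfl
    rw [hzz] at hu
    have hz0 : 0 < z.z0 := pos_of_mul_pos_left hu hZ.nonneg.h0
    have hZ0 : 0 < Z.z0 := pos_of_mul_pos_right hu hz.nonneg.h0
    exact ((inOmega_of_valid_uCond hz hz0 hUz).conv hq0 hq1 (inOmega_of_valid_uCond hZ hZ0 hUZ)).U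
  · exact uCond_of_z0_eq_zero hq0 hq1 hv (le_antisymm (not_lt.1 hu) hv.nonneg.h0)

/-- The valid cone is invariant under `a ↔ c`. [folklore] -/
theorem Valid.swapAC {q : ℝ} {Z : V5} (h : Valid q Z) : Valid q (ThreeApex.swapAC Z) := by
  rw [swapAC_eq]; exact h.swapBC.swapAB.swapBC

/-- The induction behind `U` on `InKE`: every `Z ∈ InKE q` is valid and satisfies `U_a`, `U_b` (`= U_a ∘ swapAB`) and `U_c` (`= U_a ∘ swapAC`)
(`0 < q ≤ 1`). [folklore] -/
theorem InKE.uCond_all {q : ℝ} (hq0 : 0 < q) (hq1 : q ≤ 1) {Z : V5} (h : InKE q Z) :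
    UCond q Z ∧ UCond q (ThreeApex.swapAB Z) ∧ UCond q (swapAC Z) := by
  induction h with
  | base =>
    have hd : Valid q delta0 := valid_delta0 q
    have e1 : ThreeApex.swapAB delta0 = delta0 := by ext <;> simp [ThreeApex.swapAB, delta0]
    have e2 : swapAC delta0 = delta0 := by ext <;> simp [swapAC, delta0]
    have hU : UCond q delta0 := fun w₁ w₂ _ _ => by simp [uForm, masterN, massA, swapBC, delta0]
    exact ⟨hU, e1 ▸ hU, e2 ▸ hU⟩
  | step hz hZ ih =>
    rename_i z Z'
    have hvz : Valid q z := hz.valid hq0.le hq1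
    have hvZ : Valid q Z' := hZ.valid hq0.le hq1
    have hIz : InKE q z := InKE.step hz InKE.base |> fun h => by
      have e : ThreeApex.conv z delta0 = z := by ext <;> simp [ThreeApex.conv, delta0, V5.total]
      rw [e] at h; exact h
    obtain ⟨ua, ub, uc⟩ := ih
    have hUz : UCond q z := by
      by_cases hu : 0 < z.z0
      · exact (hz.inOmega hq0.le hq1 hu).U
      · exact uCond_of_z0_eq_zero hq0 hq1 hvz (le_antisymm (not_lt.1 hu) hvz.nonneg.h0)
    have hUzB : UCond q (ThreeApex.swapAB z) := by
      by_cases hu : 0 < z.z0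
      · exact (hz.swapAB.inOmega hq0.le hq1 hu).U
      · exact uCond_of_z0_eq_zero hq0 hq1 hvz.swapAB (le_antisymm (not_lt.1 hu) hvz.nonneg.h0)
    have hUzC : UCond q (swapAC z) := by
      by_cases hu : 0 < z.z0
      · exact (hz.swapAC.inOmega hq0.le hq1 hu).U
      · exact uCond_of_z0_eq_zero hq0 hq1 hvz.swapAC (le_antisymm (not_lt.1 hu) hvz.nonneg.h0)
    refine ⟨UCond.conv hq0 hq1 hvz hvZ hUz ua, ?_, ?_⟩
    · rw [swapAB_conv]; exact UCond.conv hq0 hq1 hvz.swapAB hvZ.swapAB hUzB ub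
    · rw [swapAC_conv]; exact UCond.conv hq0 hq1 hvz.swapAC hvZ.swapAC hUzC uc
  | rim hr0 hr1 hZ ih =>
    rename_i r Z'
    have hvZ : Valid q Z' := hZ.valid hq0.le hq1
    obtain ⟨ua, ub, uc⟩ := ih
    refine ⟨ua.rimStep hq0 hq1 hr0 hr1 hvZ.nonneg, ?_, ?_⟩
    · rw [swapAB_rimStep]; exact ub.rimStep hq0 hq1 hr0 hr1 hvZ.swapAB.nonneg
    · intro w₁ w₂ hw₁ hw₂
      rw [uForm_swapAC_rimStep]
      have hq' : 0 ≤ 1 - q := sub_nonneg.2 hq1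
      have hr' : 0 ≤ 1 - r := sub_nonneg.2 hr1
      have := uc w₁ w₂ hw₁ hw₂
      positivity
  | mul hY hZ ihY ihZ =>
    rename_i Y Z'
    have hvY : Valid q Y := hY.valid hq0.le hq1
    have hvZ : Valid q Z' := hZ.valid hq0.le hq1
    obtain ⟨ya, yb, yc⟩ := ihY
    obtain ⟨za, zb, zc⟩ := ihZ
    refine ⟨UCond.conv hq0 hq1 hvY hvZ ya za, ?_, ?_⟩
    · rw [swapAB_conv]; exact UCond.conv hq0 hq1 hvY.swapAB hvZ.swapAB yb zb
    · rw [swapAC_conv]; exact UCond.conv hq0 hq1 hvY.swapAC hvZ.swapAC yc zc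

/-- **`(U_a)` on `InKE`**: `Φ_a(w₁,w₂)(Z) ≥ 0` for all `w₁,w₂ ≥ 0` and every `Z` of the rim-step closure of the three-apex monoid
(`0 < q ≤ 1`). [folklore] -/
theorem InKE.uCond {q : ℝ} (hq0 : 0 < q) (hq1 : q ≤ 1) {Z : V5} (h : InKE q Z) :
    ∀ w₁ w₂ : ℝ, 0 ≤ w₁ → 0 ≤ w₂ → 0 ≤ uForm q w₁ w₂ Z :=
  (h.uCond_all hq0 hq1).1

/-- **`(U_b)` on `InKE`** (the `a ↔ b` image: forms `N^{(ab)}, N^{(bc)}, M_b`). [folklore] -/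
theorem InKE.uCondB {q : ℝ} (hq0 : 0 < q) (hq1 : q ≤ 1) {Z : V5} (h : InKE q Z) :
    ∀ w₁ w₂ : ℝ, 0 ≤ w₁ → 0 ≤ w₂ → 0 ≤ uForm q w₁ w₂ (ThreeApex.swapAB Z) :=
  (h.uCond_all hq0 hq1).2.1

/-- **`(U_c)` on `InKE`** (the `a ↔ c` image: forms `N^{(bc)}, N^{(ac)}, M_c`). [folklore] -/
theorem InKE.uCondC {q : ℝ} (hq0 : 0 < q) (hq1 : q ≤ 1) {Z : V5} (h : InKE q Z) :
    ∀ w₁ w₂ : ℝ, 0 ≤ w₁ → 0 ≤ w₂ → 0 ≤ uForm q w₁ w₂ (swapAC Z) :=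
  (h.uCond_all hq0 hq1).2.2

/-- The determinant form of `(U_a)` on `InKE`: `J_a ≥ 0 ∨ 4N^{(ab)}N^{(ac)} ≥ (2−q)²J_a²`. [folklore] -/
theorem InKE.jA_or_det {q : ℝ} (hq0 : 0 < q) (hq1 : q ≤ 1) {Z : V5} (h : InKE q Z) :
    0 ≤ jA Z ∨ ((2 - q) * jA Z) ^ 2 ≤ 4 * masterN q (swapBC Z) * masterN q Z := by
  rcases UCond.disc hq1 (h.uCond hq0 hq1) with h1 | h1
  · exact Or.inl h1
  · right; rw [discU_eq_masterN] at h1; linarith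

end ThreeApex

end FK

end Summit.CriticalPhenomena.PercolationContinuityZ3.Theorems
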